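import Mathlib
import HarnessLib
import Summits.Ventures.LatticeQCDFlow.Exactness.SUNWilsonHMCForce
import Summits.Ventures.LatticeQCDFlow.Scoring.WilsonStapleSum
import Summits.Ventures.LatticeQCDFlow.Exactness.CabibboMarinariORSweep
import Summits.Ventures.LatticeQCDFlow.Exactness.SUNWilsonForceGradient

/-!
# THE GRADIENT OF THE `SU(N)` WILSON ACTION ALONG THE DRIFT, in general coordinates: `a ↦ βS_W(e_ε(a)·U)` is differentiable and `D(a ↦ βS_W(e_ε(a)·U))(0)[δ] = −βε Σ_e Re tr(ι(δ_e)·P(Ω_e(U)))` — Lüscher's `∂_{x,μ}S_w = P(Ω_{x,μ})`, typed, for every `N`, every torus `L ≥ 2`, every `β`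

HONEST FRAMING: exact (Metropolis-corrected) sampling algorithms for lattice gauge theory;
figures of merit are autocorrelation/cost numbers at stated couplings and volumes; no
continuum-physics claim.

Venture `LatticeQCDFlow` (cell pub-lqcd), topic `Exactness`; FANOUT row 14 (`eng-flowhmc`, family B) serving rows 21–26
(`SU(3)` rungs: row 21's baseline arm `E2 = PBC-HMC` runs the engine `latflow.core.hmc.HMC(f, β, 'leapfrog')` with the
force `(β/2)·P(Ω_e)`).  NEW WORK of the cell over the tree: row 9's `SUNLeapfrogHMC` (`sunExpDrift ι hι ε`, ANY linear
coordinates `ι : E →ₗ M_N(ℂ)` of `𝔰𝔲(N)`), `SUNExpChart` (`suExp`), `MatrixExpChart` (`contDiffAt_matrixExp`), row 21's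
`SUNWilsonHMCForce` (the engine force `sunWilsonForce N β U e`, `(β/2)·P(Ω_e)` in the coordinates `sunCoordι N`),
row 9's `SUNWilsonForceGradient` (the ONE-LINK directional derivative of `(β/N)S_W` along `t ↦ e^{tιc} ·_e U` in the
engine's coordinates, and `re_trace_mul_eq_re_trace_mul_suProj`, used here by name), `Scoring/WilsonStapleSum`
(`wilsonAction_mulSingle_sub`: the action is AFFINE in each single link, `stapleSum`, `plaquetteLoopSum_eq_mul_stapleSum`), the
Literature Wilson action / loop sum / projection `suProj = P` (`ConstructiveQFTWave0`, `WilsonFlow`, used by name); nothing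
is cited as a fact; no number.  Printed counterpart, NAMED ONLY: Lüscher, CMP 293 (2010) 899, App. A.

WHAT IS NEW over `SUNWilsonForceGradient`: ALL LINKS AT ONCE — the JOINT differentiability of
`a ↦ βS_W(e_ε(a)·U)` on `(links → E)` and its full Fréchet differential at `a = 0` (the hypotheses `hd` / `hD` of the
energy-error laws `SUNExpDriftWork` / `SUNLeapfrogEnergyError`), in ANY coordinates `ι`.

* `sunExpDrift_single` (`e_ε(δ_e a) = mulSingle e (exp ι(εa))`); **`differentiableAt_wilsonAction_sunExpDrift`** —
  `a ↦ β·S_W(e_ε(a)·U)` is differentiable EVERYWHERE (matrix exponential, products, conjugate transposes, traces);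
  **`hasDerivAt_wilsonAction_mulSingle_suExp`** — along one link, `t ↦ β·S_W(mulSingle_e(exp(tι X))·U)` has derivative
  `−β Re tr(ι X · U_e · R_e(U))` at `0` (the action is affine in the link; `d/dt exp(tY)|₀ = Y`);
  `fderiv_wilsonAction_sunExpDrift_single`; **`fderiv_wilsonAction_sunExpDrift_apply`** —
  `D(a ↦ βS_W(e_ε(a)·U))(0)[δ] = −βε·Σ_e Re tr(ι(δ_e)·U_e·R_e(U))`; **`fderiv_wilsonAction_sunExpDrift_apply_suProj`** —
  `= −βε·Σ_e Re tr(ι(δ_e)·P(Ω_e(U)))` with `Ω_e = U_e R_e = plaquetteLoopSum U e` — i.e. THE DIFFERENTIAL OF THE WILSON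
  ACTION ALONG THE DRIFT IS PAIRED, THROUGH `−Re tr`, WITH `βε·P(Ω_e)` = `2ε·ι(sunWilsonForce N β U e)`: the engine's force
  IS the gradient (in the engine's coordinates this is the `B`-representation hypothesis `hD` of
  `SUNLeapfrogEnergyError` / `SUNEngineLeapfrogEnergyError` with `D = (2ε)•sunWilsonForce N β U`; sequel).

NOT CLAIMED: `L = 1` (a plaquette may contain a link twice); the identification `−Re tr(ι c·ι c') = sunCoordPairing N c c'`
for the engine's coordinates (sequel, with `SUNEnginePairing`); higher derivatives; any number.
-/

noncomputable section

namespace Summit.Ventures.LatticeQCDFlow.Exactness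

open Set Function NormedSpace
open Literature.MathematicalPhysics.QuantumFieldTheory
open Literature.MathematicalPhysics.QuantumLattice (fundamentalRep fundamentalRep_apply)
open Summit.Ventures.LatticeQCDFlow.Scoring (stapleSum wilsonAction_mulSingle_sub plaquetteLoopSum_eq_mul_stapleSum)
open scoped Matrix Matrix.Norms.Operator

set_option backward.isDefEq.respectTransparency false

/-! ## The differential of `a ↦ βS_W(e_ε(a)·U)` in all links at once -/

section Gradient

variable (N : ℕ) {E : Type*} [NormedAddCommGroup E] [NormedSpace ℝ E] [FiniteDimensional ℝ E]
  (ι : E →ₗ[ℝ] Matrix (Fin N) (Fin N) ℂ) (hι : ∀ a, (ι a)ᴴ = -ι a ∧ (ι a).trace = 0)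
  {d L : ℕ}

omit [FiniteDimensional ℝ E] in
/-- The drift of a momentum supported on one link is a single-link update:
`e_ε(Pi.single e a) = Pi.mulSingle e (exp ι(εa))`. -/
theorem sunExpDrift_single (ε : ℝ) (e : Edge d L) (a : E) :
    sunExpDrift (L := Edge d L) ι hι ε (Pi.single e a) = Pi.mulSingle e (suExp ι hι (ε • a)) := by
  funext e'
  by_cases h : e' = e
  · subst h
    rw [sunExpDrift_apply, Pi.single_eq_same, Pi.mulSingle_eq_same]
  · rw [sunExpDrift_apply, Pi.single_eq_of_ne h, Pi.mulSingle_eq_of_ne h, smul_zero, suExp_zero]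

omit [FiniteDimensional ℝ E] in
/-- `M ↦ Re tr M` is a continuous `ℝ`-linear functional (used to differentiate through traces). -/
theorem differentiable_re_trace : Differentiable ℝ fun M : Matrix (Fin N) (Fin N) ℂ => M.trace.re := by
  have h1 : Differentiable ℝ fun M : Matrix (Fin N) (Fin N) ℂ => M.trace :=
    (LinearMap.toContinuousLinearMap (((Matrix.traceLinearMap (Fin N) ℂ ℂ).restrictScalars ℝ))).differentiable
  exact Complex.reCLM.differentiable.comp h1

omit [FiniteDimensional ℝ E] in
/-- `W ↦ Wᴴ` is differentiable (a real-linear map on a finite-dimensional space). -/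
theorem differentiable_conjTranspose_sun : Differentiable ℝ fun W : Matrix (Fin N) (Fin N) ℂ => Wᴴ := by
  let CT : Matrix (Fin N) (Fin N) ℂ →ₗ[ℝ] Matrix (Fin N) (Fin N) ℂ :=
    { toFun := fun W => Wᴴ,
      map_add' := fun A B => Matrix.conjTranspose_add A B,
      map_smul' := fun r A => by rw [Matrix.conjTranspose_smul, RingHom.id_apply, star_trivial] }
  exact (LinearMap.toContinuousLinearMap CT).differentiable

variable [NeZero L]

/-- **`a ↦ β·S_W(e_ε(a)·U)` IS DIFFERENTIABLE EVERYWHERE** (every `N`, every torus, every `β`, any coordinates): each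
link of the drifted field is `exp(ι(εa_e))·U_e`, a smooth function of `a`; plaquette holonomies are products of links
and their conjugate transposes; the action is a finite sum of real parts of traces. -/
theorem differentiableAt_wilsonAction_sunExpDrift (β ε : ℝ) (U : GaugeConfig d L (Matrix.specialUnitaryGroup (Fin N) ℂ))
    (a₀ : Edge d L → E) :
    DifferentiableAt ℝ (fun a : Edge d L → E => β * wilsonAction (suRep N) (sunExpDrift ι hι ε a * U)) a₀ := by
  -- every link matrix is differentiable in `a`
  have hlink : ∀ e : Edge d L, DifferentiableAt ℝ (fun a : Edge d L → E =>
      (((sunExpDrift ι hι ε a * U) e : Matrix.specialUnitaryGroup (Fin N) ℂ) : Matrix (Fin N) (Fin N) ℂ)) a₀ := by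
    intro e
    have hfun : (fun a : Edge d L → E =>
        (((sunExpDrift ι hι ε a * U) e : Matrix.specialUnitaryGroup (Fin N) ℂ) : Matrix (Fin N) (Fin N) ℂ)) =
        fun a : Edge d L → E => exp (ι (ε • a e)) * ((U e : Matrix.specialUnitaryGroup (Fin N) ℂ) : Matrix (Fin N) (Fin N) ℂ) := by
      funext a
      rw [Pi.mul_apply, sunExpDrift_apply, Submonoid.coe_mul, coe_suExp]
    rw [hfun]
    have hlin : Differentiable ℝ (fun a : Edge d L → E => ι (ε • a e)) :=
      (LinearMap.toContinuousLinearMap ι).differentiable.comp ((differentiable_apply e).const_smul ε)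
    exact (((contDiffAt_matrixExp _).differentiableAt (by simp)).comp a₀ (hlin a₀)).mul_const _
  -- hence every plaquette holonomy
  have hct := differentiable_conjTranspose_sun N
  have hhol : ∀ (x : Site d L) (μ ν : Fin d), DifferentiableAt ℝ (fun a : Edge d L → E =>
      ((plaquetteHolonomy (sunExpDrift ι hι ε a * U) x μ ν : Matrix.specialUnitaryGroup (Fin N) ℂ) :
        Matrix (Fin N) (Fin N) ℂ)) a₀ := by
    intro x μ ν
    unfold plaquetteHolonomy
    simp only [WilsonFlow.coe_mul_SU, WilsonFlow.coe_inv_SU]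
    exact (((hlink _).mul (hlink _)).mul ((hct _).comp a₀ (hlink _))).mul ((hct _).comp a₀ (hlink _))
  -- the action is a finite sum of `N − Re tr`
  have hre := differentiable_re_trace N
  unfold wilsonAction
  refine (DifferentiableAt.fun_sum fun p _ => ?_).const_mul β
  simp only [suRep_apply]
  exact (differentiableAt_const _).sub ((hre _).comp a₀ (hhol _ _ _))

omit [FiniteDimensional ℝ E] in
/-- **ALONG ONE LINK THE ACTION IS AFFINE, so its derivative is a trace**: for `L ≥ 2`, every `X : E`, link `e = (x, μ)`:
`d/dt|₀ β·S_W(mulSingle_e(exp(t ι X))·U) = −β·Re tr(ι X · U_e · R_e(U))`, `R_e` the staple sum. -/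
theorem hasDerivAt_wilsonAction_mulSingle_suExp (hL : 2 ≤ L) (β : ℝ)
    (U : GaugeConfig d L (Matrix.specialUnitaryGroup (Fin N) ℂ)) (x : Site d L) (μ : Fin d) (X : E) :
    HasDerivAt (fun t : ℝ => β * wilsonAction (suRep N) (Pi.mulSingle (x, μ) (suExp ι hι (t • X)) * U))
      (-(β * (ι X * ((U (x, μ) : Matrix.specialUnitaryGroup (Fin N) ℂ) : Matrix (Fin N) (Fin N) ℂ) *
        stapleSum (suRep N) U x μ).trace.re)) 0 := by
  have hρ : Continuous (suRep N) := continuous_suRep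
  -- the affine formula, as a function of `t`
  set M : Matrix (Fin N) (Fin N) ℂ := ((U (x, μ) : Matrix.specialUnitaryGroup (Fin N) ℂ) : Matrix (Fin N) (Fin N) ℂ) *
    stapleSum (suRep N) U x μ with hM
  have hform : ∀ t : ℝ, β * wilsonAction (suRep N) (Pi.mulSingle (x, μ) (suExp ι hι (t • X)) * U) =
      β * wilsonAction (suRep N) U + β * M.trace.re - β * (exp (t • ι X) * M).trace.re := by
    intro t
    have h := wilsonAction_mulSingle_sub (suRep N) hL hρ U x μ (suExp ι hι (t • X))
    rw [suRep_apply, suRep_apply, Submonoid.coe_mul, coe_suExp, map_smul, Matrix.mul_assoc] at h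
    linarith [congrArg (fun r => β * r) h, mul_sub β (M.trace.re) ((exp (t • ι X) * M).trace.re)]
  have hfun : (fun t : ℝ => β * wilsonAction (suRep N) (Pi.mulSingle (x, μ) (suExp ι hι (t • X)) * U)) =
      fun t : ℝ => β * wilsonAction (suRep N) U + β * M.trace.re - β * (exp (t • ι X) * M).trace.re := funext hform
  rw [hfun]
  -- differentiate `t ↦ Re tr(exp(tY)·M)` at 0
  have hexp : HasDerivAt (fun t : ℝ => exp (t • ι X) * M) (ι X * M) 0 := by
    have h := (hasDerivAt_exp_smul_const (𝕂 := ℝ) (ι X) (0 : ℝ)).mul_const M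
    rw [zero_smul, exp_zero, one_mul] at h
    exact h
  have hreTr : HasDerivAt (fun t : ℝ => (exp (t • ι X) * M).trace.re) ((ι X * M).trace.re) 0 := by
    have hlin : HasFDerivAt (fun A : Matrix (Fin N) (Fin N) ℂ => A.trace.re)
        (Complex.reCLM.comp (LinearMap.toContinuousLinearMap ((Matrix.traceLinearMap (Fin N) ℂ ℂ).restrictScalars ℝ)))
        (exp ((0 : ℝ) • ι X) * M) :=
      (Complex.reCLM.comp (LinearMap.toContinuousLinearMap
        ((Matrix.traceLinearMap (Fin N) ℂ ℂ).restrictScalars ℝ))).hasFDerivAt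
    exact hlin.comp_hasDerivAt (0 : ℝ) hexp
  have hfin := (hreTr.const_mul β).const_sub (β * wilsonAction (suRep N) U + β * M.trace.re)
  rw [Matrix.mul_assoc]
  exact hfin

/-- **The differential on a momentum supported on one link**:
`D(a ↦ βS_W(e_ε(a)·U))(0)[Pi.single e c] = −βε·Re tr(ι c · U_e · R_e(U))`. -/
theorem fderiv_wilsonAction_sunExpDrift_single (hL : 2 ≤ L) (β ε : ℝ)
    (U : GaugeConfig d L (Matrix.specialUnitaryGroup (Fin N) ℂ)) (x : Site d L) (μ : Fin d) (c : E) :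
    fderiv ℝ (fun a : Edge d L → E => β * wilsonAction (suRep N) (sunExpDrift ι hι ε a * U)) 0 (Pi.single (x, μ) c) =
      -(β * ε * (ι c * ((U (x, μ) : Matrix.specialUnitaryGroup (Fin N) ℂ) : Matrix (Fin N) (Fin N) ℂ) *
        stapleSum (suRep N) U x μ).trace.re) := by
  set F : (Edge d L → E) → ℝ := fun a => β * wilsonAction (suRep N) (sunExpDrift ι hι ε a * U) with hF
  -- the derivative of `t ↦ F(t • single e c)` at 0 is `fderiv F 0 (single e c)` …
  have hline : HasDerivAt (fun t : ℝ => t • (Pi.single (x, μ) c : Edge d L → E)) (Pi.single (x, μ) c) 0 := by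
    simpa using (hasDerivAt_id (0 : ℝ)).smul_const (Pi.single (x, μ) c : Edge d L → E)
  have h0 : (fun t : ℝ => t • (Pi.single (x, μ) c : Edge d L → E)) 0 = 0 := zero_smul ℝ _
  have hF0 : HasFDerivAt F (fderiv ℝ F 0) ((fun t : ℝ => t • (Pi.single (x, μ) c : Edge d L → E)) 0) := by
    rw [h0]
    exact (differentiableAt_wilsonAction_sunExpDrift N ι hι β ε U 0).hasFDerivAt
  have h1 : HasDerivAt (F ∘ fun t : ℝ => t • (Pi.single (x, μ) c : Edge d L → E)) (fderiv ℝ F 0 (Pi.single (x, μ) c)) 0 :=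
    hF0.comp_hasDerivAt (0 : ℝ) hline
  -- … and that function is the single-link path of `hasDerivAt_wilsonAction_mulSingle_suExp` with `X = εc`
  have hpath : (F ∘ fun t : ℝ => t • (Pi.single (x, μ) c : Edge d L → E)) =
      fun t : ℝ => β * wilsonAction (suRep N) (Pi.mulSingle (x, μ) (suExp ι hι (t • (ε • c))) * U) := by
    funext t
    simp only [Function.comp_apply, hF]
    rw [← Pi.single_smul, sunExpDrift_single, smul_comm ε t c]
  rw [hpath] at h1
  have h2 := hasDerivAt_wilsonAction_mulSingle_suExp N ι hι hL β U x μ (ε • c)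
  have heq := h1.unique h2
  rw [heq, map_smul, Matrix.smul_mul, Matrix.smul_mul, Matrix.trace_smul, Complex.real_smul, Complex.re_ofReal_mul]
  ring

/-- **THE DIFFERENTIAL OF THE WILSON ACTION ALONG THE DRIFT** (staple form): for `L ≥ 2`,
`D(a ↦ βS_W(e_ε(a)·U))(0)[δ] = −βε·Σ_e Re tr(ι(δ_e) · U_e · R_e(U))`. -/
theorem fderiv_wilsonAction_sunExpDrift_apply (hL : 2 ≤ L) (β ε : ℝ)
    (U : GaugeConfig d L (Matrix.specialUnitaryGroup (Fin N) ℂ)) (δ : Edge d L → E) :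
    fderiv ℝ (fun a : Edge d L → E => β * wilsonAction (suRep N) (sunExpDrift ι hι ε a * U)) 0 δ =
      ∑ e : Edge d L, -(β * ε * (ι (δ e) * ((U e : Matrix.specialUnitaryGroup (Fin N) ℂ) : Matrix (Fin N) (Fin N) ℂ) *
        stapleSum (suRep N) U e.1 e.2).trace.re) := by
  conv_lhs => rw [← Finset.univ_sum_single δ]
  rw [map_sum]
  refine Finset.sum_congr rfl fun e _ => ?_
  exact fderiv_wilsonAction_sunExpDrift_single N ι hι hL β ε U e.1 e.2 (δ e)

/-- **LÜSCHER'S FORM: THE DIFFERENTIAL IS PAIRED WITH `P(Ω_e)`**: for `L ≥ 2`,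
`D(a ↦ βS_W(e_ε(a)·U))(0)[δ] = −βε·Σ_e Re tr(ι(δ_e) · P(Ω_e(U)))`, `Ω_e = plaquetteLoopSum U e`, `P = suProj` — the
matrix `βε·P(Ω_e) = 2ε·ι(sunWilsonForce N β U e)` (`sunCoordι_sunWilsonForce`): the engine's force is the gradient. -/
theorem fderiv_wilsonAction_sunExpDrift_apply_suProj (hL : 2 ≤ L) (β ε : ℝ)
    (U : GaugeConfig d L (Matrix.specialUnitaryGroup (Fin N) ℂ)) (δ : Edge d L → E) :
    fderiv ℝ (fun a : Edge d L → E => β * wilsonAction (suRep N) (sunExpDrift ι hι ε a * U)) 0 δ =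
      ∑ e : Edge d L, -(β * ε * (ι (δ e) * suProj (plaquetteLoopSum U e.1 e.2)).trace.re) := by
  rw [fderiv_wilsonAction_sunExpDrift_apply N ι hι hL β ε U δ]
  refine Finset.sum_congr rfl fun e _ => ?_
  have hstaple : stapleSum (suRep N) U e.1 e.2 = stapleSum (fundamentalRep (Fin N)) U e.1 e.2 := rfl
  rw [Matrix.mul_assoc, hstaple, ← plaquetteLoopSum_eq_mul_stapleSum U e.1 e.2,
    re_trace_mul_eq_re_trace_mul_suProj (hι (δ e)).1 (hι (δ e)).2]

end Gradient

end Summit.Ventures.LatticeQCDFlow.Exactness
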